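import Summits.QuantumAdvantage.Dequantization.GraphStateRotationCorrelators
import HarnessLib

/-!
# Graph-state rotation learning — general product inputs (Lemmas E25-1/E25-2, part 1)

HONEST FRAMING: instance-level adjudication of specific advantage claims; no claim about
BQP vs BPP or the summit.

Source modelled: arXiv:2509.09033v1, Definition 16 / Algorithm 1 (the "graph-state rotation"
learning task).  On input `x ∈ {0,1}ⁿ` wire `a` is prepared in `|+⟩` if `x_a = 0` ("active")
and in `|0⟩` if `x_a = 1` ("inactive"); then `RZ(θ_a) = e^{-iθ_a Z}` on every wire, `CZ` on
every edge of `G`, `H` on every wire, measure.  The base module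
`GraphStateRotationCorrelators` treats `x = 0ⁿ`; this module treats a general `x`
(the reduction to the active subgraph `G_x` is in `GraphStateRotationActiveGraph`).

Main results (cell note DEQ-E25 §2):

* `hadCorr_eq_autocorrelation` — for ANY diagonal data `f`, the parity moments of `H^{⊗n} f`
  are the autocorrelations `Σ_z conj f(z) f(z ⊕ 1_S)` (the engine of the base file, generic);
* `correlatorX_eq_prod` — Lemma E25-2 for general `x`: `E[χ_S(y) | x]` is `0` if `S` touches
  an inactive wire and `(-1)^{e_G(S)} ∏_{a active} wire_a(S)` otherwise (inactive wires drop
  out of the product: an inactive wire with `m_a(S)` odd does NOT kill the correlator);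
* `sum_probX`, `probBitOneX_eq`, `probBitOneX_of_decoupled` — the learning statistic (S.4.13)
  under "local decoupling" (`x_a = 0`, all neighbours of `a` inactive: `Pr[y_a = 1 | x] =
  sin² θ_a`); `probBitOneX_of_adj_active` / `probBitOneX_of_inactive` — an active neighbour,
  resp. `x_a = 1`, makes the bit a fair coin; `amplitudeX_allFalse` — `x = 0ⁿ` is the base case.
Everything is proved from the definitions (no axioms beyond Mathlib's, no `sorry`).
Convention: `RZ(θ) = exp(-iθZ)`, `sgn b = (-1)^b`, `χ_S(y) = ∏_{a∈S} (-1)^{y_a}`.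
-/

noncomputable section

namespace Summit.QuantumAdvantage.Dequantization.GraphStateRotationCorrelators

open Finset Matrix
open scoped ComplexConjugate
open Literature.Probability.RandomGraphs.LowDegree (sgn walsh sgn_true sgn_false walsh_empty)
open Literature.Computability.Complexity.LowDegree (sum_walsh_mul_walsh_index)
open Literature.Computability.Cryptography (QReg hGateAll)
open Literature.Barriers.QuantumAdvantage (supp bxor indic symmDiff_supp_eq_iff
  walsh_mul_walsh_eq_symmDiff hGateAll_apply_eq sqrt_two_inv_pow_mul_self walsh_supp_comm)

variable {n : ℕ} (G : SimpleGraph (Fin n)) [DecidableRel G.Adj] (θ : Fin n → ℝ)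

/-! ### Generic engine: parity moments of a Hadamard transform are autocorrelations -/

/-- `A_f(y) = (1/√2)^n Σ_z χ_{supp y}(z) f(z)`: the amplitude `⟨y| H^{⊗n} |f⟩` of the
(unnormalised) vector `f`. -/
def hadAmp (f : QReg n → ℂ) (y : QReg n) : ℂ :=
  ((Real.sqrt 2 : ℂ)⁻¹) ^ n * ∑ z, ((walsh (supp y) z : ℝ) : ℂ) * f z

/-- `Σ_y |A_f(y)|² χ_S(y)`, the `S`-parity moment of the output weights of `H^{⊗n} |f⟩`. -/
def hadCorr (f : QReg n → ℂ) (S : Finset (Fin n)) : ℂ :=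
  ∑ y, (hadAmp f y * conj (hadAmp f y)) * ((walsh S y : ℝ) : ℂ)

/-- `|A_f(y)|²` as a double character sum. -/
theorem hadAmp_mul_conj (f : QReg n → ℂ) (y : QReg n) :
    hadAmp f y * conj (hadAmp f y) = ((2 : ℂ) ^ n)⁻¹ *
      ∑ z, ∑ z', ((walsh (symmDiff (supp z) (supp z')) y : ℝ) : ℂ) *
        (f z * conj (f z')) := by
  rw [hadAmp, map_mul, map_pow, map_inv₀, Complex.conj_ofReal, map_sum,
    show ∀ (c A B : ℂ), c * A * (c * B) = c * c * (A * B) from fun c A B => by ring,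
    sqrt_two_inv_pow_mul_self, Finset.sum_mul_sum]
  congr 1
  refine Finset.sum_congr rfl fun z _ => Finset.sum_congr rfl fun z' _ => ?_
  rw [map_mul, Complex.conj_ofReal, ← walsh_mul_walsh_eq_symmDiff, walsh_supp_comm z y,
    walsh_supp_comm z' y]
  push_cast; ring

/-- **Parity moments are autocorrelations** (generic): for every `f`,
`Σ_y |A_f(y)|² χ_S(y) = Σ_z conj f(z) · f(z ⊕ 1_S)`. -/
theorem hadCorr_eq_autocorrelation (f : QReg n → ℂ) (S : Finset (Fin n)) :
    hadCorr f S = ∑ z', conj (f z') * f (bxor z' (indic S)) := by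
  have h2 : (2 : ℂ) ^ n ≠ 0 := pow_ne_zero _ two_ne_zero
  unfold hadCorr
  simp_rw [hadAmp_mul_conj]
  have step : ∀ y : QReg n, ((2 : ℂ) ^ n)⁻¹ *
      (∑ z, ∑ z', ((walsh (symmDiff (supp z) (supp z')) y : ℝ) : ℂ) * (f z * conj (f z'))) *
        ((walsh S y : ℝ) : ℂ) =
      ((2 : ℂ) ^ n)⁻¹ * ∑ z, ∑ z',
        ((walsh (symmDiff (supp z) (supp z')) y * walsh S y : ℝ) : ℂ) *
          (f z * conj (f z')) := by
    intro y
    rw [mul_assoc, Finset.sum_mul]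
    congr 1
    refine Finset.sum_congr rfl fun z _ => ?_
    rw [Finset.sum_mul]
    refine Finset.sum_congr rfl fun z' _ => ?_
    push_cast; ring
  simp_rw [step]
  rw [← Finset.mul_sum, Finset.sum_comm]
  simp_rw [Finset.sum_comm (s := (univ : Finset (QReg n))) (t := (univ : Finset (QReg n)))
    (f := fun y z' => ((walsh (symmDiff (supp _) (supp z')) y * walsh S y : ℝ) : ℂ) * _)]
  have hw : ∀ z z' : QReg n,
      ∑ y, ((walsh (symmDiff (supp z) (supp z')) y * walsh S y : ℝ) : ℂ) *
        (f z * conj (f z')) =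
      if z = bxor z' (indic S) then (2 : ℂ) ^ n * (f z * conj (f z')) else 0 := by
    intro z z'
    rw [← Finset.sum_mul, ← Complex.ofReal_sum, sum_walsh_mul_walsh_index]
    by_cases h : z = bxor z' (indic S)
    · rw [if_pos ((symmDiff_supp_eq_iff z z' S).mpr h), if_pos h]; push_cast; ring
    · rw [if_neg (fun h' => h ((symmDiff_supp_eq_iff z z' S).mp h')), if_neg h]; push_cast; ring
  simp_rw [hw]
  rw [Finset.sum_comm]
  simp_rw [Finset.sum_ite_eq' univ, if_pos (Finset.mem_univ _)]
  rw [← Finset.mul_sum, ← mul_assoc, inv_mul_cancel₀ h2, one_mul]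
  exact Finset.sum_congr rfl fun z' _ => by ring

/-! ### The model on a general product input `x` -/

/-- `⟨z|ψ_x⟩` for the product input of Definition 16: wire `a` carries `|+⟩` if `x_a = 0`
and `|0⟩` if `x_a = 1`. -/
def inputAmp (x z : QReg n) : ℂ :=
  ∏ a, if x a = true then (if z a = true then 0 else 1) else ((Real.sqrt 2 : ℂ)⁻¹)

/-- The set `A_x = {a : x_a = 0}` of ACTIVE wires. -/
def active (x : QReg n) : Finset (Fin n) := univ.filter fun a => x a = false

/-- The basis strings in the support of `|ψ_x⟩`: `z_a = 0` on every inactive wire. -/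
def basisOn (x : QReg n) : Finset (QReg n) :=
  Fintype.piFinset fun a => if x a = true then ({false} : Finset Bool) else univ

/-- The output amplitude `⟨y| H^{⊗n} · CZ_G RZ(θ) |ψ_x⟩` of Algorithm 1 on input `x`. -/
def amplitudeX (x y : QReg n) : ℂ :=
  ((hGateAll n * Matrix.diagonal (phase G θ)) *ᵥ inputAmp x) y

/-- The output probability `p(y | x)`. -/
def probX (x y : QReg n) : ℝ := ‖amplitudeX G θ x y‖ ^ 2

/-- The conditional parity correlator `E[χ_S(y) | x] = Σ_y p(y|x) χ_S(y)`. -/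
def correlatorX (x : QReg n) (S : Finset (Fin n)) : ℝ := ∑ y, probX G θ x y * walsh S y

/-- `Pr[y_a = 1 | x]`, the single-site statistic the learner reads off. -/
def probBitOneX (x : QReg n) (a : Fin n) : ℝ :=
  ∑ y ∈ univ.filter (fun y : QReg n => y a = true), probX G θ x y

/-- `a` is active iff `x_a = 0`. -/
theorem mem_active {x : QReg n} {a : Fin n} : a ∈ active x ↔ x a = false := by
  simp [active]

/-- `z` lies in the support of `|ψ_x⟩` iff it vanishes on the inactive wires. -/
theorem mem_basisOn (x z : QReg n) : z ∈ basisOn x ↔ ∀ a, x a = true → z a = false := by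
  simp only [basisOn, Fintype.mem_piFinset]
  refine forall_congr' fun a => ?_
  cases hx : x a <;> simp

/-- `⟨z|ψ_x⟩ = (1/√2)^{|A_x|}` on the support and `0` off it. -/
theorem inputAmp_eq (x z : QReg n) :
    inputAmp x z = if z ∈ basisOn x then ((Real.sqrt 2 : ℂ)⁻¹) ^ (active x).card else 0 := by
  unfold inputAmp
  split_ifs with hz
  · rw [mem_basisOn] at hz
    have hf : (univ.filter fun a => ¬ x a = true) = active x := by
      unfold active; exact Finset.filter_congr (fun a _ => by simp)
    have h1 : ∀ a ∈ univ.filter (fun a => x a = true),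
        (if z a = true then (0 : ℂ) else 1) = 1 := fun a ha => by
      rw [(hz a (Finset.mem_filter.mp ha).2)]; simp
    rw [Finset.prod_ite, Finset.prod_eq_one h1, one_mul, Finset.prod_const, hf]
  · rw [mem_basisOn] at hz
    push Not at hz
    obtain ⟨a, hxa, hza⟩ := hz
    have hza' : z a = true := by simpa using hza
    exact Finset.prod_eq_zero (Finset.mem_univ a) (by rw [if_pos hxa, if_pos hza'])

/-- `⟨z|ψ_x⟩` is real. -/
theorem conj_inputAmp (x z : QReg n) : conj (inputAmp x z) = inputAmp x z := by
  rw [inputAmp, map_prod]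
  exact Finset.prod_congr rfl fun a _ => by split_ifs <;> simp

/-- `⟨z|ψ_x⟩⟨z'|ψ_x⟩ = 2^{-|A_x|}` if both lie in the support, else `0`. -/
theorem inputAmp_mul_inputAmp (x z z' : QReg n) :
    inputAmp x z * inputAmp x z' =
      if z ∈ basisOn x ∧ z' ∈ basisOn x then ((2 : ℂ) ^ (active x).card)⁻¹ else 0 := by
  rw [inputAmp_eq, inputAmp_eq]
  by_cases hz : z ∈ basisOn x
  · by_cases hz' : z' ∈ basisOn x
    · rw [if_pos hz, if_pos hz', if_pos ⟨hz, hz'⟩, sqrt_two_inv_pow_mul_self]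
    · rw [if_neg hz', mul_zero, if_neg (fun h => hz' h.2)]
  · rw [if_neg hz, zero_mul, if_neg (fun h => hz h.1)]

/-- The output amplitude is the Hadamard transform of `z ↦ phase(z) ⟨z|ψ_x⟩`. -/
theorem amplitudeX_eq (x y : QReg n) :
    amplitudeX G θ x y = hadAmp (fun z => phase G θ z * inputAmp x z) y := by
  simp only [amplitudeX, hadAmp, Matrix.mulVec, dotProduct, Matrix.mul_diagonal,
    hGateAll_apply_eq]
  rw [Finset.mul_sum]
  exact Finset.sum_congr rfl fun z _ => by ring

/-- The conditional correlator is a parity moment of that Hadamard transform. -/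
theorem correlatorX_eq_hadCorr (x : QReg n) (S : Finset (Fin n)) :
    ((correlatorX G θ x S : ℝ) : ℂ) = hadCorr (fun z => phase G θ z * inputAmp x z) S := by
  unfold correlatorX hadCorr probX
  rw [Complex.ofReal_sum]
  refine Finset.sum_congr rfl fun y _ => ?_
  rw [Complex.ofReal_mul, ← Complex.normSq_eq_norm_sq, ← Complex.mul_conj, amplitudeX_eq]

/-- **`E[χ_S | x]` as a restricted autocorrelation of the phase function**:
`E[χ_S | x] = 2^{-|A_x|} Σ_{z, z ⊕ 1_S ∈ supp ψ_x} conj f(z) f(z ⊕ 1_S)`. -/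
theorem correlatorX_eq_sum (x : QReg n) (S : Finset (Fin n)) :
    ((correlatorX G θ x S : ℝ) : ℂ) = ((2 : ℂ) ^ (active x).card)⁻¹ *
      ∑ z, (if z ∈ basisOn x ∧ bxor z (indic S) ∈ basisOn x
        then conj (phase G θ z) * phase G θ (bxor z (indic S)) else 0) := by
  rw [correlatorX_eq_hadCorr, hadCorr_eq_autocorrelation, Finset.mul_sum]
  refine Finset.sum_congr rfl fun z _ => ?_
  rw [map_mul, conj_inputAmp,
    show ∀ A B C D : ℂ, A * B * (C * D) = (A * C) * (B * D) from fun _ _ _ _ => by ring,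
    inputAmp_mul_inputAmp]
  split_ifs <;> ring

/-- Flipping the bits of `S` leaves the support iff `S` contains an inactive wire (here: leaves). -/
theorem bxor_indic_not_mem_basisOn {x z : QReg n} {S : Finset (Fin n)} {a : Fin n}
    (ha : a ∈ S) (hxa : x a = true) (hz : z ∈ basisOn x) : bxor z (indic S) ∉ basisOn x := by
  rw [mem_basisOn] at hz ⊢
  intro h
  have h1 := h a hxa
  have h2 := hz a hxa
  simp [bxor, indic, ha, h2] at h1

/-- Flipping the bits of a set of active wires preserves the support. -/
theorem bxor_indic_mem_basisOn {x z : QReg n} {S : Finset (Fin n)}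
    (hS : ∀ a ∈ S, x a = false) (hz : z ∈ basisOn x) : bxor z (indic S) ∈ basisOn x := by
  rw [mem_basisOn] at hz ⊢
  intro a hxa
  have haS : a ∉ S := fun h => by rw [hS a h] at hxa; exact Bool.false_ne_true hxa
  simp [bxor, indic, haS, hz a hxa]

/-- **A parity touching an inactive wire is unbiased**: `a ∈ S`, `x_a = 1 ⟹ E[χ_S | x] = 0`. -/
theorem correlatorX_eq_zero_of_inactive {x : QReg n} {S : Finset (Fin n)} {a : Fin n}
    (ha : a ∈ S) (hxa : x a = true) : correlatorX G θ x S = 0 := by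
  have h := correlatorX_eq_sum G θ x S
  have hz : ∀ z ∈ (univ : Finset (QReg n)),
      (if z ∈ basisOn x ∧ bxor z (indic S) ∈ basisOn x
        then conj (phase G θ z) * phase G θ (bxor z (indic S)) else 0) = 0 :=
    fun z _ => if_neg (fun hh => bxor_indic_not_mem_basisOn ha hxa hh.1 hh.2)
  rw [Finset.sum_eq_zero hz, mul_zero] at h
  exact_mod_cast h

/-- **Closed form on the active wires**: if `S ⊆ A_x` then
`E[χ_S | x] = (-1)^{e_G(S)} ∏_{a ∈ A_x} wire_a(S)` (the wire factors of the base file, the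
product running over ACTIVE wires only). -/
theorem correlatorX_eq_prod_of_active {x : QReg n} {S : Finset (Fin n)}
    (hS : ∀ a ∈ S, x a = false) :
    ((correlatorX G θ x S : ℝ) : ℂ) =
      (-1) ^ edgesIn G S * ∏ a ∈ active x, wire G θ S a := by
  have h2 : (2 : ℂ) ^ (active x).card ≠ 0 := pow_ne_zero _ two_ne_zero
  rw [correlatorX_eq_sum]
  have h1 : ∑ z, (if z ∈ basisOn x ∧ bxor z (indic S) ∈ basisOn x
        then conj (phase G θ z) * phase G θ (bxor z (indic S)) else 0) =
      ∑ z ∈ basisOn x, conj (phase G θ z) * phase G θ (bxor z (indic S)) := by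
    rw [← Finset.sum_subset (Finset.subset_univ (basisOn x))]
    · exact Finset.sum_congr rfl fun z hz => if_pos ⟨hz, bxor_indic_mem_basisOn hS hz⟩
    · intro z _ hz; exact if_neg (fun h => hz h.1)
  rw [h1]
  simp_rw [autocorr_summand]
  rw [← Finset.mul_sum]
  have hfac : ∑ z ∈ basisOn x, ∏ a, (((sgn (z a) : ℝ) : ℂ) ^ nbrIn G S a *
        (if a ∈ S then expI (2 * θ a * sgn (z a)) else 1)) =
      ∏ a, ∑ b ∈ (if x a = true then ({false} : Finset Bool) else univ),
        (((sgn b : ℝ) : ℂ) ^ nbrIn G S a * (if a ∈ S then expI (2 * θ a * sgn b) else 1)) :=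
    (Finset.prod_univ_sum (fun a => if x a = true then ({false} : Finset Bool) else univ)
      (fun a (b : Bool) => ((sgn b : ℝ) : ℂ) ^ nbrIn G S a *
        (if a ∈ S then expI (2 * θ a * sgn b) else 1))).symm
  have hwire : ∀ a, ∑ b ∈ (if x a = true then ({false} : Finset Bool) else univ),
        (((sgn b : ℝ) : ℂ) ^ nbrIn G S a * (if a ∈ S then expI (2 * θ a * sgn b) else 1)) =
      if x a = true then 1 else 2 * wire G θ S a := by
    intro a
    by_cases hxa : x a = true
    · have haS : a ∉ S := fun h => by rw [hS a h] at hxa; exact Bool.false_ne_true hxa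
      rw [if_pos hxa, if_pos hxa, Finset.sum_singleton, sgn_false, if_neg haS]; simp
    · rw [if_neg hxa, if_neg hxa]; exact wire_sum G θ S a
  have hf : (univ.filter fun a => ¬ x a = true) = active x := by
    unfold active; exact Finset.filter_congr (fun a _ => by simp)
  rw [hfac, Finset.prod_congr rfl (fun a _ => hwire a), czSign_indic, Finset.prod_ite,
    Finset.prod_const_one, one_mul, Finset.prod_mul_distrib, Finset.prod_const, hf,
    show ∀ A B : ℂ, ((2 : ℂ) ^ (active x).card)⁻¹ * (A * ((2 : ℂ) ^ (active x).card * B))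
      = (((2 : ℂ) ^ (active x).card)⁻¹ * (2 : ℂ) ^ (active x).card) * (A * B)
      from fun A B => by ring,
    inv_mul_cancel₀ h2, one_mul]

/-- **Lemma E25-2 for a general input `x` (closed form of every conditional parity correlator).**
`E[χ_S(y) | x] = [S ⊆ A_x] · (-1)^{e_G(S)} ∏_{a ∈ A_x} wire_a(S)`, `wire_a` as in the base
file (`cos 2θ_a` / `i sin 2θ_a` for `a ∈ S` with `m_a(S)` even / odd, `1` / `0` for `a ∉ S`
with `m_a(S)` even / odd).  [DEQ-E25 §2; derived from arXiv:2509.09033v1 Def. 16] -/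
theorem correlatorX_eq_prod (x : QReg n) (S : Finset (Fin n)) :
    ((correlatorX G θ x S : ℝ) : ℂ) =
      if (∀ a ∈ S, x a = false) then (-1) ^ edgesIn G S * ∏ a ∈ active x, wire G θ S a
      else 0 := by
  split_ifs with hS
  · exact correlatorX_eq_prod_of_active G θ hS
  · push Not at hS
    obtain ⟨a, ha, hxa⟩ := hS
    rw [correlatorX_eq_zero_of_inactive G θ ha (by simpa using hxa), Complex.ofReal_zero]

/-! ### Normalisation and single-site statistics -/

/-- `m_a(∅) = 0`. -/
theorem nbrIn_empty (a : Fin n) : nbrIn G ∅ a = 0 := by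
  rw [nbrIn, Finset.card_eq_zero, Finset.filter_eq_empty_iff]
  rintro b - ⟨-, hb⟩
  exact Finset.notMem_empty b hb

/-- `e_G(∅) = 0`. -/
theorem edgesIn_empty : edgesIn G ∅ = 0 := by
  rw [edgesIn, Finset.card_eq_zero, Finset.filter_eq_empty_iff]
  rintro p - ⟨-, -, h1, -⟩
  exact Finset.notMem_empty _ h1

/-- `wire_a(∅) = 1`. -/
theorem wire_empty (a : Fin n) : wire G θ ∅ a = 1 := by
  rw [wire, if_neg (Finset.notMem_empty a), nbrIn_empty, if_pos Even.zero]

/-- **Normalisation** `Σ_y p(y|x) = 1`. -/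
theorem sum_probX (x : QReg n) : ∑ y, probX G θ x y = 1 := by
  have h := correlatorX_eq_prod_of_active G θ (x := x) (S := ∅)
    (fun a ha => absurd ha (Finset.notMem_empty a))
  rw [edgesIn_empty, pow_zero, one_mul, Finset.prod_eq_one (fun a _ => wire_empty G θ a)] at h
  simp only [correlatorX, walsh_empty, mul_one] at h
  exact_mod_cast h

/-- `Pr[y_a = 1 | x] = (1 - E[(-1)^{y_a} | x]) / 2`. -/
theorem probBitOneX_eq (x : QReg n) (a : Fin n) :
    probBitOneX G θ x a = (1 - correlatorX G θ x {a}) / 2 := by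
  have h : ∀ y : QReg n, probX G θ x y * walsh {a} y =
      probX G θ x y - 2 * (if y a = true then probX G θ x y else 0) := fun y => by
    rw [walsh, Finset.prod_singleton]
    cases y a
    · simp
    · rw [if_pos rfl, sgn_true]; ring
  rw [probBitOneX, Finset.sum_filter, correlatorX, Finset.sum_congr rfl fun y _ => h y,
    Finset.sum_sub_distrib, sum_probX, ← Finset.mul_sum]
  ring

/-- **An inactive output bit is a fair coin**: `x_a = 1 ⟹ Pr[y_a = 1 | x] = 1/2`. -/
theorem probBitOneX_of_inactive {x : QReg n} {a : Fin n} (hxa : x a = true) :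
    probBitOneX G θ x a = 1 / 2 := by
  rw [probBitOneX_eq, correlatorX_eq_zero_of_inactive G θ (Finset.mem_singleton_self a) hxa]
  norm_num

/-- **(S.4.13) under local decoupling.** If `x_a = 0` and every neighbour of `a` is inactive
(`x_b = 1`), then `Pr[y_a = 1 | x] = sin² θ_a`: the site reveals its angle. -/
theorem probBitOneX_of_decoupled {x : QReg n} {a : Fin n} (hxa : x a = false)
    (hnb : ∀ b, G.Adj a b → x b = true) : probBitOneX G θ x a = Real.sin (θ a) ^ 2 := by
  have hS : ∀ b ∈ ({a} : Finset (Fin n)), x b = false := fun b hb => by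
    rw [Finset.mem_singleton.mp hb]; exact hxa
  have hw : ∀ b ∈ active x, b ≠ a → wire G θ {a} b = 1 := fun b hb hba => by
    have hxb : x b = false := mem_active.mp hb
    have hnadj : ¬ G.Adj b a := fun h => by
      have := hnb b h.symm; rw [hxb] at this; exact Bool.false_ne_true this
    rw [wire, if_neg (by rwa [Finset.mem_singleton]), nbrIn_singleton, if_neg hnadj,
      if_pos Even.zero]
  have hwa : wire G θ {a} a = Real.cos (2 * θ a) := by
    rw [wire, if_pos (Finset.mem_singleton_self a), nbrIn_singleton, if_neg (G.irrefl (v := a)),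
      if_pos Even.zero]
  have h := correlatorX_eq_prod_of_active G θ hS
  rw [edgesIn_singleton, pow_zero, one_mul,
    Finset.prod_eq_single_of_mem a (mem_active.mpr hxa) hw, hwa] at h
  have hc : correlatorX G θ x {a} = Real.cos (2 * θ a) := by exact_mod_cast h
  rw [probBitOneX_eq, hc, Real.cos_two_mul, Real.sin_sq]
  ring

/-- **An active neighbour hides the angle**: `x_a = x_b = 0`, `a ~ b ⟹ Pr[y_a = 1 | x] = 1/2`. -/
theorem probBitOneX_of_adj_active {x : QReg n} {a b : Fin n} (hxa : x a = false)
    (hab : G.Adj a b) (hxb : x b = false) : probBitOneX G θ x a = 1 / 2 := by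
  have hS : ∀ c ∈ ({a} : Finset (Fin n)), x c = false := fun c hc => by
    rw [Finset.mem_singleton.mp hc]; exact hxa
  have hba : b ≠ a := by rintro rfl; exact G.irrefl hab
  have hwb : wire G θ {a} b = 0 := by
    rw [wire, if_neg (by rwa [Finset.mem_singleton]), nbrIn_singleton, if_pos hab.symm,
      if_neg Nat.not_even_one]
  have h := correlatorX_eq_prod_of_active G θ hS
  rw [Finset.prod_eq_zero (mem_active.mpr hxb) hwb, mul_zero] at h
  have hc : correlatorX G θ x {a} = 0 := by exact_mod_cast h
  rw [probBitOneX_eq, hc]; norm_num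

/-- On `x = 0ⁿ` the amplitudes of this module are those of the base module. -/
theorem amplitudeX_allFalse (y : QReg n) :
    amplitudeX G θ (fun _ => false) y = amplitude G θ y := by
  rw [amplitudeX_eq, hadAmp, amplitude_eq]
  have hi : ∀ z : QReg n,
      inputAmp (fun _ : Fin n => false) z = ((Real.sqrt 2 : ℂ)⁻¹) ^ n := by
    intro z; unfold inputAmp; simp [Finset.prod_const, Finset.card_univ]
  simp_rw [hi]
  rw [← sqrt_two_inv_pow_mul_self, mul_assoc]
  simp_rw [Finset.mul_sum]
  exact Finset.sum_congr rfl fun z _ => by ring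

/-- On `x = 0ⁿ`, `p(y|x) = p(y)`. -/
theorem probX_allFalse (y : QReg n) : probX G θ (fun _ => false) y = prob G θ y := by
  rw [probX, prob, amplitudeX_allFalse]

/-- On `x = 0ⁿ`, `E[χ_S | x] = E[χ_S]`. -/
theorem correlatorX_allFalse (S : Finset (Fin n)) :
    correlatorX G θ (fun _ => false) S = correlator G θ S := by
  unfold correlatorX correlator
  simp_rw [probX_allFalse]

end Summit.QuantumAdvantage.Dequantization.GraphStateRotationCorrelators
end
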